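import Mathlib.RingTheory.Artinian.Module
import Mathlib.RingTheory.SimpleModule.WedderburnArtin
import Mathlib.LinearAlgebra.Dual.Lemmas
import Literature.NumberTheory.Kottwitz1992.InvolutionsHolds
import Literature.NumberTheory.Kottwitz1992.InvolutionsLemma22Holds
import Literature.NumberTheory.Kottwitz1992.InvolutionsLemma23bHolds
import Literature.NumberTheory.Kottwitz1992.InvolutionsLemma28Holds
import HarnessLib

/-!
# [Kottwitz1992, Lemma 2.10 p. 382] `*`-homomorphisms up to conjugacy — DISCHARGED:
# `Kottwitz1992_2_10_starHom_conjugacy_holds`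

Kernel-lane companion of the statement carpet ★ `Literature/NumberTheory/Kottwitz1992/Involutions.lean` (squad TK; builds on ★
`InvolutionsHolds` (Lemma 2.3 (1)), ★ `InvolutionsLemma22Holds` (Lemma 2.2), ★ `InvolutionsLemma23bHolds` (Lemma 2.3 (2)), ★
`InvolutionsLemma26bHolds` (Lemma 2.6 (2)), ★ `InvolutionsLemma27Holds` (Lemma 2.7 and the remark on `(x, y)_b`), ★ `InvolutionsLemma28Holds`
(Lemma 2.8)): the named fact ★ `Involutions.Kottwitz1992_2_10_starHom_conjugacy` — for finite-dimensional semisimple `ℝ`-algebras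
`(B, *_B)`, `(C, *_C)` with positive involution, «Any homomorphism `i` from `B` to `C` is conjugate under `C^×` to a `*`-homomorphism.  If two
`*`-homomorphisms `i₁, i₂` from `B` to `C` are conjugate under `C^×`, then they are conjugate by an element `c` of `C` satisfying
`c c* = 1`» — is PROVED here as `theorem Kottwitz1992_2_10_starHom_conjugacy_holds : Kottwitz1992_2_10_starHom_conjugacy B ι C ιC`.
THEOREMS ONLY (no definition, no named fact, no `sorry`, no instance, no notation); cell hodgecm-mathlib, seat B-typ04 (g30); net debt −1.

R. E. Kottwitz, *Points on some Shimura varieties over finite fields*, J. Amer. Math. Soc. 5 (1992), Lemma 2.10 p. 382, proof p. 382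
L17–L33 (held `paper:doi-10-2307-2152772`, p0010).  THE PRINTED PROOF: «First we prove the first statement.  Using `i`, we make `C` into a
`C ⊗_ℝ B^opp`-module.  Since the tensor product of `*_B` and `*_C` is a positive involution of `C ⊗_ℝ B^opp`, there exists a positive definite
Hermitian form on the `C ⊗_ℝ B^opp`-module `C`.  This form can be written as `(x, y)_c` for some `c ∈ C₊`, and since `(x, y)_c` is Hermitian
for `B^opp`, we have `i(b) c = c i(b*)*` for all `b ∈ B`.  Write `c = d d*` for some `d ∈ C^×`.  Then `Int(d)⁻¹ ∘ i` is a `*`-homomorphism.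
Next we prove the second statement.  Consider the positive definite Hermitian `C ⊗_ℝ C^opp`-module `(C, tr_{C/ℝ}(x y*))`.  Using `i₁` and
`i₂`, we regard `C` as a positive definite Hermitian `C ⊗_ℝ B^opp`-module in two ways.  These two Hermitian modules are isomorphic as modules
since `i₁` and `i₂` are conjugate under `C^×`; therefore by Lemma 2.6 they are isomorphic as Hermitian modules.  Therefore there exists
`c ∈ C^×` that conjugates `i₁` into `i₂` and has the property that right multiplication by `c` preserves the form `tr_{C/ℝ} x y*`, or in other
words, `c c* = 1`.»  Followed here step by step, in the tree's currency (`(x, y)_c` = ★ `trForm ιC c x y = tr_{C/ℝ}(x c y*)`, `C₊` = ★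
`posElts ιC`, `*`-homomorphism = ★ `IsStarHom`, the standing hypotheses ★ `IsAlgebraWithInvolution`, ★ `IsPositiveInvolution`):
* §1 ONE STEP THE PRINT LEAVES IMPLICIT: the facts of §2 (Lemma 2.2 (1), Lemma 2.6 (2)) are typed for SEMISIMPLE algebras, and they are
  applied to `A = C ⊗_ℝ B^opp`; we prove that a finite-dimensional `ℝ`-algebra carrying a positive involution `σ` is semisimple (it is
  Artinian, its Jacobson radical `J` is nilpotent, and for `u ∈ J` the element `σ(u) u ∈ J` is nilpotent, so `tr_{A/ℝ}(σ(u) σ(u)*) =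
  tr_{A/ℝ}(σ(u) u) = 0`, whence `u = 0` by positivity), so no hypothesis is added;
* §2 the index calculus on `C`: every bilinear form `φ` on `C` with `φ(c x, y) = φ(x, c* y)` «can be written as `(x, y)_c`» (the
  isomorphism of the Notation paragraph, p. 381: `x ↦ (z ↦ tr(z* x))` is injective by the nondegeneracy of the trace form, ★
  `Kottwitz1992_2_trForm_symm_alt_nondegenerate_holds`, hence bijective onto the dual), and the index is unique;
* §3 the algebra `A = C ⊗_ℝ B^opp` with `σ = *_C ⊗ *_B` (positive by ★ Lemma 2.3 (1), (2); semisimple by §1) and the `A`-module `C`,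
  `(c ⊗ b) · x = c x i(b)`: the index forms `(x, y)_{c₀}` with `c₀ ∈ C₊` commuting with `i(B)` are positive definite Hermitian when `i` is a
  `*`-homomorphism, and an `A`-linear automorphism of `C` is right multiplication by a unit commuting with `i(B)`;
* §4 the first statement, as printed (Lemma 2.2 (1) for `A`, §2, `i(b) c = c i(b*)*`, `c = d d*` by ★ Lemma 2.8, `Int(d)⁻¹ ∘ i`);
* §5 the second statement, as printed, with the two Hermitian module structures realised on the ONE `A`-module `(C, i₁)` as the two forms
  `tr(x y*)` and its transport `tr(x u⁻¹ (y u⁻¹)*)` along the module isomorphism `x ↦ x u⁻¹` onto `(C, i₂)` (`i₂ = Int(u) ∘ i₁`); Lemma 2.6 (2)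
  gives an isometry `S`, `S(x) = x v` with `v` commuting with `i₁(B)` and `v v* = u⁻¹ (u⁻¹)*`, and `c = u v` has `c c* = 1`, `Int(c) ∘ i₁ = i₂`;
* §6 the discharge.
HONEST LABEL: HC_CM is proved only modulo the 7 printed citations (2 remaining: hLiu418, h413) until rung 0 closes; this file adds no citation
debt (0 facts, 0 sorry) and discharges 1 named fact of ★ `Involutions`.

## References
* [Kottwitz1992] R. E. Kottwitz, Points on some Shimura varieties over finite fields, J. Amer. Math. Soc. 5 (1992) 373–444, Lemma 2.10 and
  its proof, p. 382; Lemma 2.2 p. 379, Lemma 2.3 p. 380, Lemma 2.6 (2) p. 380, Lemma 2.7 and the Notation paragraph p. 381, Lemma 2.8 p. 381.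
-/

noncomputable section

namespace Literature.NumberTheory.Kottwitz1992.Involutions

open TensorProduct MulOpposite
open Literature.NumberTheory.Automorphic (leftMulTrace leftMulTrace_apply)

universe u

/-! ## §1 A finite-dimensional `ℝ`-algebra with a positive involution is semisimple -/

section Semisimple

variable {A : Type u} [Ring A] [Algebra ℝ A] {σ : A →ₗ[ℝ] A}

/-- A finite-dimensional `ℝ`-algebra `A` with a positive involution `σ` is semisimple: `A` is Artinian, its Jacobson radical `J` is
nilpotent, and for `u ∈ J` the element `σ(u) u ∈ J` is nilpotent, so `L_{σ(u) u}` has trace `0`; but `tr(σ(u) σ(u)*) = tr(σ(u) u) > 0`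
unless `σ(u) = 0`, i.e. `u = 0`.  Hence `J = 0`.  (The print applies Lemma 2.2 and Lemma 2.6 to `C ⊗_ℝ B^opp`; this is why that algebra
satisfies their standing hypothesis.) [cite: Kottwitz1992, Lemma 2.10 (p. 382)] -/
private theorem isSemisimpleRing_of_isPositiveInvolution [FiniteDimensional ℝ A] (hσ : IsPositiveInvolution A σ) :
    IsSemisimpleRing A := by
  haveI : IsArtinianRing A := IsArtinianRing.of_finite ℝ A
  rw [IsArtinianRing.isSemisimpleRing_iff_jacobson, eq_bot_iff]
  intro u hu
  rw [Ideal.mem_bot]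
  obtain ⟨n, hn⟩ := IsSemiprimaryRing.isNilpotent (R := A)
  have hv : σ u * u ∈ Ring.jacobson A := Ideal.mul_mem_left _ _ hu
  have hvn : (σ u * u) ^ n = 0 := by
    have h := Ideal.pow_mem_pow hv n
    rw [hn, Ideal.zero_eq_bot, Ideal.mem_bot] at h
    exact h
  have htr : leftMulTrace ℝ A (σ u * u) = 0 := by
    have h1 : IsNilpotent (Algebra.lmul ℝ A (σ u * u)) := ⟨n, by rw [← map_pow, hvn, map_zero]⟩
    rw [leftMulTrace_apply]
    exact (LinearMap.isNilpotent_trace_of_isNilpotent h1).eq_zero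
  by_contra hu0
  have hσu : σ u ≠ 0 := fun h => hu0 (by rw [← hσ.apply_apply u, h, map_zero])
  have hpos := hσ.trace_mul_self_pos (σ u) hσu
  rw [hσ.apply_apply, htr] at hpos
  exact lt_irrefl 0 hpos

end Semisimple

/-! ## §2 The index calculus on `C`: «This form can be written as `(x, y)_c`» -/

section Index

variable {C : Type u} [Ring C] [Algebra ℝ C] {ιC : C →ₗ[ℝ] C}

/-- An involution fixes `1`. [cite: Kottwitz1992, §1 (p. 378)] -/
private theorem invol_map_one (hι : IsInvolution ℝ C ιC) : ιC 1 = 1 := by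
  have h : ιC (ιC 1 * 1) = ιC 1 * ιC (ιC 1) := hι.map_mul (ιC 1) 1
  rw [mul_one, hι.apply_apply, mul_one] at h
  exact h.symm

/-- An involution maps units to units: `(c⁻¹)* c* = (c c⁻¹)* = 1`. [cite: Kottwitz1992, §1 (p. 378)] -/
private theorem invol_units_inv_mul (hι : IsInvolution ℝ C ιC) (c : Cˣ) : ιC ((c⁻¹ : Cˣ) : C) * ιC (c : C) = 1 := by
  rw [← hι.map_mul, Units.mul_inv, invol_map_one hι]

/-- `c* (c⁻¹)* = (c⁻¹ c)* = 1`. [cite: Kottwitz1992, §1 (p. 378)] -/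
private theorem invol_units_mul_inv (hι : IsInvolution ℝ C ιC) (c : Cˣ) : ιC (c : C) * ιC ((c⁻¹ : Cˣ) : C) = 1 := by
  rw [← hι.map_mul, Units.inv_mul, invol_map_one hι]

/-- `(c⁻¹)* (c* a) = a`. [cite: Kottwitz1992, §1 (p. 378)] -/
private theorem invol_units_inv_mul_cancel_left (hι : IsInvolution ℝ C ιC) (c : Cˣ) (a : C) :
    ιC ((c⁻¹ : Cˣ) : C) * (ιC (c : C) * a) = a := by
  rw [← mul_assoc, invol_units_inv_mul hι, one_mul]

/-- `c* ((c⁻¹)* a) = a`. [cite: Kottwitz1992, §1 (p. 378)] -/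
private theorem invol_units_mul_inv_cancel_left (hι : IsInvolution ℝ C ιC) (c : Cˣ) (a : C) :
    ιC (c : C) * (ιC ((c⁻¹ : Cˣ) : C) * a) = a := by
  rw [← mul_assoc, invol_units_mul_inv hι, one_mul]

variable (ιC) in
/-- The form `(x, y)_b` on `C` as a Mathlib bilinear form (existence only; the file declares no definition). [cite: Kottwitz1992, §2 Notation (p. 381)] -/
private theorem exists_bilinForm_trForm (b : C) :
    ∃ φ : LinearMap.BilinForm ℝ C, ∀ x y : C, φ x y = trForm ιC b x y :=
  ⟨LinearMap.mk₂ ℝ (fun x y => trForm ιC b x y)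
      (fun x x' y => by simp only [trForm, add_mul, map_add])
      (fun t x y => by simp only [trForm, smul_mul_assoc, map_smul, smul_eq_mul])
      (fun x y y' => by simp only [trForm, map_add, mul_add])
      (fun t x y => by simp only [trForm, map_smul, mul_smul_comm, smul_eq_mul]),
    fun _ _ => rfl⟩

/-- `(x, y)_{c b c*} = (x c, y c)_b`. [cite: Kottwitz1992, §2 Notation (p. 381)] -/
private theorem trForm_conj (hι : IsInvolution ℝ C ιC) (c b x y : C) :
    trForm ιC (c * b * ιC c) x y = trForm ιC b (x * c) (y * c) := by
  unfold trForm
  rw [hι.map_mul]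
  simp only [mul_assoc]

/-- `tr_{C/ℝ}(x y) = tr_{C/ℝ}(y x)`. [folklore] -/
private theorem lmTrace_comm (x y : C) : leftMulTrace ℝ C (x * y) = leftMulTrace ℝ C (y * x) := by
  rw [leftMulTrace_apply, leftMulTrace_apply, map_mul (Algebra.lmul ℝ C), map_mul (Algebra.lmul ℝ C),
    LinearMap.trace_mul_comm]

/-- UNIQUENESS OF THE INDEX: `(x, y)_c = (x, y)_{c′}` for all `x, y` forces `c = c′` (nondegeneracy of `(x, y)_1`, the remark after Lemma
2.7). [cite: Kottwitz1992, §2 Notation (p. 381)] -/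
private theorem index_injective (hC : IsAlgebraWithInvolution C ιC) {c c' : C}
    (h : ∀ x y : C, trForm ιC c x y = trForm ιC c' x y) : c = c' := by
  have hnd := (Kottwitz1992_2_trForm_symm_alt_nondegenerate_holds C ιC hC 1).2.2.mpr isUnit_one (c - c') fun y => by
    have h1 := h 1 y
    unfold trForm at h1 ⊢
    rw [one_mul, one_mul] at h1
    rw [mul_one, sub_mul, map_sub, h1, sub_self]
  exact sub_eq_zero.mp hnd

/-- EXISTENCE OF THE INDEX («This form can be written as `(x, y)_c`», p. 382 L21; the Notation paragraph p. 381: «we get an isomorphism from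
`B` to the real vector space of all bilinear forms `(x, y)` on `B` such that `(bx, y) = (x, b*y)`»): a bilinear form `φ` on `C` with
`φ(c x, y) = φ(x, c* y)` is `(x, y)_{c₀}` for some `c₀` — `φ(x, y) = φ(1, x* y)` is a linear functional of `x* y`, and every functional is
`z ↦ tr(z* c₀)` (this map `C → C^*` is injective by nondegeneracy of the trace form, hence bijective). [cite: Kottwitz1992, §2 Notation (p. 381)] -/
private theorem exists_index (hC : IsAlgebraWithInvolution C ιC) (φ : LinearMap.BilinForm ℝ C)
    (hφ : ∀ (c x y : C), φ (c * x) y = φ x (ιC c * y)) : ∃ c₀ : C, ∀ x y : C, φ x y = trForm ιC c₀ x y := by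
  haveI : FiniteDimensional ℝ C := hC.finiteDimensional
  haveI : IsSemisimpleRing C := hC.isSemisimpleRing
  have hι : IsInvolution ℝ C ιC := hC.isInvolution
  -- `θ c₀ = (z ↦ tr(z* c₀))`
  let θ : C →ₗ[ℝ] Module.Dual ℝ C :=
    { toFun := fun c₀ => leftMulTrace ℝ C ∘ₗ LinearMap.mulRight ℝ c₀ ∘ₗ ιC
      map_add' := fun a b => by ext z; simp [mul_add]
      map_smul' := fun r a => by ext z; simp }
  have hθ : ∀ c₀ z : C, θ c₀ z = leftMulTrace ℝ C (ιC z * c₀) := fun c₀ z => rfl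
  have hinj : Function.Injective θ := by
    rw [← LinearMap.ker_eq_bot, LinearMap.ker_eq_bot']
    intro c₀ hc₀
    refine (Kottwitz1992_2_trForm_symm_alt_nondegenerate_holds C ιC hC 1).2.2.mpr isUnit_one c₀ fun y => ?_
    unfold trForm
    rw [mul_one, lmTrace_comm, ← hθ, hc₀, LinearMap.zero_apply]
  let Θ : C ≃ₗ[ℝ] Module.Dual ℝ C := LinearMap.linearEquivOfInjective θ hinj (Subspace.dual_finrank_eq).symm
  have hΘ : ∀ c₀, Θ c₀ = θ c₀ := fun _ => rfl
  obtain ⟨c₀, hc₀⟩ : ∃ c₀ : C, θ c₀ = φ 1 := ⟨Θ.symm (φ 1), by rw [← hΘ, LinearEquiv.apply_symm_apply]⟩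
  refine ⟨c₀, fun x y => ?_⟩
  have h1 : φ x y = φ 1 (ιC x * y) := by rw [← hφ, mul_one]
  rw [h1, ← hc₀, hθ, hι.map_mul, hι.apply_apply, trForm, mul_assoc, lmTrace_comm]

/-- `b b* ∈ C₊` for `b ∈ C^×` when `*` is positive (the easy half of ★ Lemma 2.8's last clause). [cite: Kottwitz1992, Lemma 2.8 (p. 381)] -/
private theorem mul_invol_mem_posElts (hC : IsAlgebraWithInvolution C ιC) (hpos : IsPositiveInvolution C ιC) (b : Cˣ) :
    (b : C) * ιC b ∈ posElts ιC := by
  rw [(Kottwitz1992_2_8_posElts_cone_transitive_holds C ιC hC hpos).2.2.2.2.2.2]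
  exact ⟨b, rfl⟩

/-- `C₊ ⊆ {d d* | d ∈ C^×}` (the hard half of ★ Lemma 2.8's last clause). [cite: Kottwitz1992, Lemma 2.8 (p. 381)] -/
private theorem exists_units_of_mem_posElts (hC : IsAlgebraWithInvolution C ιC) (hpos : IsPositiveInvolution C ιC) {c : C}
    (hc : c ∈ posElts ιC) : ∃ d : Cˣ, c = (d : C) * ιC d := by
  rw [(Kottwitz1992_2_8_posElts_cone_transitive_holds C ιC hC hpos).2.2.2.2.2.2] at hc
  exact hc

end Index

/-! ## §3 The algebra `A = C ⊗_ℝ B^opp`, its involution `σ = *_C ⊗ *_B`, and the `A`-module `C` -/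

section TensorModule

variable {B : Type u} [Ring B] [Algebra ℝ B] {ι : B →ₗ[ℝ] B}
variable {C : Type u} [Ring C] [Algebra ℝ C] {ιC : C →ₗ[ℝ] C}

variable (ι) in
/-- Unfolding of the involution `σ = *_C ⊗ *_B^{opp}` on pure tensors: `σ(c ⊗ b^op) = c* ⊗ (b*)^op`. [cite: Kottwitz1992, Lemma 2.3 (2) (p. 380)] -/
private theorem sigma_tmul (c : C) (b : Bᵐᵒᵖ) :
    TensorProduct.map ιC ((opLinearEquiv ℝ).toLinearMap ∘ₗ ι ∘ₗ (opLinearEquiv ℝ (M := B)).symm.toLinearMap) (c ⊗ₜ[ℝ] b) =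
      ιC c ⊗ₜ[ℝ] op (ι (unop b)) := by
  rw [TensorProduct.map_tmul]
  rfl

variable (ι ιC) in
/-- «Since the tensor product of `*_B` and `*_C` is a positive involution of `C ⊗_ℝ B^opp`» (p. 382 L19–L20): `σ = *_C ⊗ *_B^{opp}` is a positive
involution (★ Lemma 2.3 (1) for `B^opp`, ★ Lemma 2.3 (2) for the tensor product) AND `(C ⊗_ℝ B^opp, σ)` satisfies the standing hypothesis of
§2 (finite-dimensional; semisimple by §1). [cite: Kottwitz1992, Lemma 2.10 (p. 382)] -/
private theorem tensor_isAlgebraWithInvolution (hB : IsAlgebraWithInvolution B ι) (hpos : IsPositiveInvolution B ι)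
    (hC : IsAlgebraWithInvolution C ιC) (hposC : IsPositiveInvolution C ιC) :
    IsAlgebraWithInvolution (C ⊗[ℝ] Bᵐᵒᵖ)
        (TensorProduct.map ιC ((opLinearEquiv ℝ).toLinearMap ∘ₗ ι ∘ₗ (opLinearEquiv ℝ (M := B)).symm.toLinearMap)) ∧
      IsPositiveInvolution (C ⊗[ℝ] Bᵐᵒᵖ)
        (TensorProduct.map ιC ((opLinearEquiv ℝ).toLinearMap ∘ₗ ι ∘ₗ (opLinearEquiv ℝ (M := B)).symm.toLinearMap)) := by
  haveI : FiniteDimensional ℝ B := hB.finiteDimensional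
  haveI : IsSemisimpleRing B := hB.isSemisimpleRing
  haveI : FiniteDimensional ℝ C := hC.finiteDimensional
  have hposBop := Kottwitz1992_2_3_1_op_holds ι hB hpos
  have hBop : IsAlgebraWithInvolution Bᵐᵒᵖ
      ((opLinearEquiv ℝ).toLinearMap ∘ₗ ι ∘ₗ (opLinearEquiv ℝ (M := B)).symm.toLinearMap) :=
    ⟨inferInstance, inferInstance, hposBop.toIsInvolution⟩
  have hposA := (Kottwitz1992_2_3_2_tensor_prod_holds C ιC Bᵐᵒᵖ _ hC hBop hposC hposBop).1
  exact ⟨⟨inferInstance, isSemisimpleRing_of_isPositiveInvolution hposA, hposA.toIsInvolution⟩, hposA⟩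

/-- The `A = C ⊗_ℝ B^opp`-module `C`, «using `i`» (p. 382 L18–L19): `(c ⊗ b^op) · x = c x i(b)`.  Any `A`-module structure on `C` whose pure
tensors act this way is compatible with the real structure (`IsScalarTower`). [cite: Kottwitz1992, Lemma 2.10 (p. 382)] -/
private theorem tensor_isScalarTower (i : B →ₐ[ℝ] C) [Module (C ⊗[ℝ] Bᵐᵒᵖ) C]
    (hsm : ∀ (c : C) (b : Bᵐᵒᵖ) (x : C), (c ⊗ₜ[ℝ] b) • x = c * (x * i (unop b))) :
    IsScalarTower ℝ (C ⊗[ℝ] Bᵐᵒᵖ) C := by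
  refine ⟨fun r a x => ?_⟩
  induction a using TensorProduct.induction_on with
  | zero =>
    -- (the zero of `C ⊗ B^opp` is rewritten as `0 ⊗ 0` so that only the action of pure tensors is used)
    rw [← TensorProduct.zero_tmul C (0 : Bᵐᵒᵖ), TensorProduct.smul_tmul', hsm, hsm, smul_mul_assoc]
  | tmul c b => rw [TensorProduct.smul_tmul', hsm, hsm, smul_mul_assoc]
  | add a₁ a₂ h₁ h₂ => rw [smul_add, add_smul, add_smul, h₁, h₂, smul_add]

/-- For a `*`-homomorphism `i` and an index `c₀ ∈ C₊` commuting with `i(B)`, the form `(x, y)_{c₀}` is a positive definite Hermitian form on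
the `A`-module `C` (`A = C ⊗_ℝ B^opp` acting through `i`, involution `σ`): on pure tensors `((c ⊗ b^op) x, y)_{c₀} = tr(c x i(b) c₀ y*) =
tr(x c₀ i(b) y* c) = (x, c* y i(b*))_{c₀} = (x, σ(c ⊗ b^op) y)_{c₀}`, using `i(b*)* = i(b)`, `tr(zw) = tr(wz)` and `i(b) c₀ = c₀ i(b)`.
(For `c₀ = 1` this is the printed «positive definite Hermitian `C ⊗_ℝ C^opp`-module `(C, tr_{C/ℝ}(x y*))`» regarded «using `i₁`».)
[cite: Kottwitz1992, Lemma 2.10 (p. 382)] -/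
private theorem isPosDefHermitianForm_index (hB : IsInvolution ℝ B ι) (hC : IsAlgebraWithInvolution C ιC) (i : B →ₐ[ℝ] C)
    (hi : IsStarHom ι ιC i) [Module (C ⊗[ℝ] Bᵐᵒᵖ) C]
    (hsm : ∀ (c : C) (b : Bᵐᵒᵖ) (x : C), (c ⊗ₜ[ℝ] b) • x = c * (x * i (unop b)))
    {c₀ : C} (hc₀ : c₀ ∈ posElts ιC) (hcomm : ∀ b : B, i b * c₀ = c₀ * i b)
    {φ : LinearMap.BilinForm ℝ C} (hφ : ∀ x y : C, φ x y = trForm ιC c₀ x y) :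
    IsPosDefHermitianForm (C ⊗[ℝ] Bᵐᵒᵖ) C
      (TensorProduct.map ιC ((opLinearEquiv ℝ).toLinearMap ∘ₗ ι ∘ₗ (opLinearEquiv ℝ (M := B)).symm.toLinearMap)) φ := by
  have hιC : IsInvolution ℝ C ιC := hC.isInvolution
  refine ⟨⟨fun x y => ?_, fun a x y => ?_⟩, fun v hv => by rw [hφ]; exact hc₀.2 v hv⟩
  · rw [hφ, hφ]
    exact ((Kottwitz1992_2_trForm_symm_alt_nondegenerate_holds C ιC hC c₀).1.mpr hc₀.1) x y
  · induction a using TensorProduct.induction_on with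
    | zero =>
      rw [← TensorProduct.zero_tmul C (0 : Bᵐᵒᵖ), sigma_tmul, hsm, hsm, map_zero ιC, zero_mul, zero_mul, map_zero φ,
        LinearMap.zero_apply, (φ x).map_zero]
    | tmul c b =>
      rw [sigma_tmul, hsm, hsm, unop_op, hφ, hφ]
      -- `i(b*)* = i(b)`
      have hib : ιC (i (ι (unop b))) = i (unop b) := by rw [← hi, hB.apply_apply]
      unfold trForm
      rw [hιC.map_mul, hιC.map_mul, hιC.apply_apply, hib]
      -- `tr(c x i(b) c₀ y*) = tr(x c₀ i(b) y* c)`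
      simp only [mul_assoc]
      rw [lmTrace_comm c]
      simp only [mul_assoc]
      rw [← mul_assoc (i (unop b)) c₀, hcomm, mul_assoc]
    | add a₁ a₂ h₁ h₂ => simp only [add_smul, map_add, LinearMap.add_apply, h₁, h₂]

/-- An `A`-linear automorphism `S` of the `A`-module `C` (`A = C ⊗_ℝ B^opp` acting through `i`) is right multiplication by the unit
`v = S(1)` (`S` commutes with the left multiplications `c ⊗ 1`), and `v` commutes with `i(B)` (`S` commutes with the right multiplications
`1 ⊗ b^op`).  (The printed «there exists `c ∈ C^×` that conjugates `i₁` into `i₂` and … right multiplication by `c` preserves the form».)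
[cite: Kottwitz1992, Lemma 2.10 (p. 382)] -/
private theorem linearEquiv_structure (i : B →ₐ[ℝ] C) [Module (C ⊗[ℝ] Bᵐᵒᵖ) C]
    (hsm : ∀ (c : C) (b : Bᵐᵒᵖ) (x : C), (c ⊗ₜ[ℝ] b) • x = c * (x * i (unop b))) (S : C ≃ₗ[C ⊗[ℝ] Bᵐᵒᵖ] C) :
    ∃ v : Cˣ, (∀ x : C, S x = x * v) ∧ ∀ b : B, i b * v = v * i b := by
  -- left `C`-linearity, from `(c ⊗ 1) · x = c x`
  have hleft : ∀ c x : C, S (c * x) = c * S x := fun c x => by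
    have h := S.map_smul (c ⊗ₜ[ℝ] (1 : Bᵐᵒᵖ)) x
    rwa [hsm, hsm, unop_one, map_one i, mul_one, mul_one] at h
  -- right compatibility, from `(1 ⊗ b^op) · x = x i(b)`
  have hright : ∀ (x : C) (b : B), S (x * i b) = S x * i b := fun x b => by
    have h := S.map_smul ((1 : C) ⊗ₜ[ℝ] op b) x
    rwa [hsm, hsm, unop_op, one_mul, one_mul] at h
  have hSx : ∀ x : C, S x = x * S 1 := fun x => by rw [← hleft, mul_one]
  have hdc : S.symm 1 * S 1 = 1 := by rw [← hSx, LinearEquiv.apply_symm_apply]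
  have hcd : S 1 * S.symm 1 = 1 := S.injective (by rw [hSx (S 1 * S.symm 1), mul_assoc, hdc, mul_one])
  refine ⟨⟨S 1, S.symm 1, hcd, hdc⟩, hSx, fun b => ?_⟩
  show i b * S 1 = S 1 * i b
  rw [← hright 1 b, one_mul, hSx (i b)]

end TensorModule

/-! ## §4–§6 Lemma 2.10 -/

section LemmaTwoTen

variable (B : Type u) [Ring B] [Algebra ℝ B] (ι : B →ₗ[ℝ] B)
variable (C : Type u) [Ring C] [Algebra ℝ C] (ιC : C →ₗ[ℝ] C)

/-- **Lemma 2.10, PROVED**: ★ `Kottwitz1992_2_10_starHom_conjugacy` holds — for finite-dimensional semisimple `ℝ`-algebras `(B, *_B)`,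
`(C, *_C)` with positive involution, «Any homomorphism `i` from `B` to `C` is conjugate under `C^×` to a `*`-homomorphism.  If two
`*`-homomorphisms `i₁, i₂` from `B` to `C` are conjugate under `C^×`, then they are conjugate by an element `c` of `C` satisfying `c c* = 1`.»
First statement (§4): `C` is a `C ⊗_ℝ B^opp`-module through `i`, `σ = *_C ⊗ *_B` is positive (Lemma 2.3) and the algebra is semisimple
(§1), so Lemma 2.2 (1) gives a positive definite Hermitian form, which is `(x, y)_c` with `c ∈ C₊` (§2) and `i(b) c = c i(b*)*`; `c = d d*`
(Lemma 2.8) and `Int(d)⁻¹ ∘ i` is a `*`-homomorphism.  Second statement (§5): on the `C ⊗_ℝ B^opp`-module `(C, i₁)` the forms `tr(x y*)`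
and `tr(x u⁻¹ (y u⁻¹)*)` (`i₂ = Int(u) ∘ i₁`) are positive definite Hermitian; Lemma 2.6 (2) gives an isometry, which is `x ↦ x v` with `v`
commuting with `i₁(B)` and `v v* = u⁻¹ (u⁻¹)*`; `c = u v`. [cite: Kottwitz1992, Lemma 2.10 (p. 382)] -/
theorem Kottwitz1992_2_10_starHom_conjugacy_holds : Kottwitz1992_2_10_starHom_conjugacy B ι C ιC := by
  intro hB hpos hC hposC
  haveI : FiniteDimensional ℝ C := hC.finiteDimensional
  have hι : IsInvolution ℝ B ι := hB.isInvolution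
  have hιC : IsInvolution ℝ C ιC := hC.isInvolution
  obtain ⟨hA, hposA⟩ := tensor_isAlgebraWithInvolution ι ιC hB hpos hC hposC
  refine ⟨fun i => ?_, fun i₁ i₂ h₁ h₂ hconj => ?_⟩
  · /- §4 FIRST STATEMENT.  «Using `i`, we make `C` into a `C ⊗_ℝ B^opp`-module.» -/
    letI : Module Bᵐᵒᵖ C := Module.compHom C (RingHom.op i.toRingHom)
    have hsmulB : ∀ (b : Bᵐᵒᵖ) (x : C), b • x = x * i (unop b) := fun b x => rfl
    haveI : IsScalarTower ℝ Bᵐᵒᵖ C :=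
      ⟨fun r b x => by rw [hsmulB, hsmulB, unop_smul, map_smul, mul_smul_comm]⟩
    haveI : SMulCommClass C Bᵐᵒᵖ C :=
      ⟨fun c b x => by rw [hsmulB, hsmulB, smul_eq_mul, smul_eq_mul, mul_assoc]⟩
    letI : Module (C ⊗[ℝ] Bᵐᵒᵖ) C := TensorProduct.Algebra.module
    have hsm : ∀ (c : C) (b : Bᵐᵒᵖ) (x : C), (c ⊗ₜ[ℝ] b) • x = c * (x * i (unop b)) := fun c b x =>
      TensorProduct.Algebra.smul_def c b x
    haveI : IsScalarTower ℝ (C ⊗[ℝ] Bᵐᵒᵖ) C := tensor_isScalarTower i hsm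
    haveI : Module.Finite (C ⊗[ℝ] Bᵐᵒᵖ) C := Module.Finite.of_restrictScalars_finite ℝ _ _
    /- «Since the tensor product of `*_B` and `*_C` is a positive involution of `C ⊗_ℝ B^opp`, there exists a positive definite Hermitian
    form on the `C ⊗_ℝ B^opp`-module `C`.» (Lemma 2.2: (3) ⇒ (1), for the semisimple (§1) algebra `C ⊗_ℝ B^opp`) -/
    have h221 : ExistsPosDefFormOnEveryModule (C ⊗[ℝ] Bᵐᵒᵖ) _ :=
      ((Kottwitz1992_2_2_tfae_holds _ hA).out 0 2).mpr hposA.trace_mul_self_pos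
    obtain ⟨φ, hφH, hφpos⟩ := h221 C
    /- «This form can be written as `(x, y)_c` for some `c ∈ C₊`» -/
    have hleftH : ∀ c x y : C, φ (c * x) y = φ x (ιC c * y) := fun c x y => by
      have h := hφH.smul_left (c ⊗ₜ[ℝ] (1 : Bᵐᵒᵖ)) x y
      rwa [sigma_tmul, hsm, hsm, unop_one, invol_map_one hι, unop_op, map_one i, mul_one, mul_one] at h
    obtain ⟨c₀, hc₀⟩ := exists_index hC φ hleftH
    have hc₀pos : c₀ ∈ posElts ιC := by
      refine ⟨(Kottwitz1992_2_trForm_symm_alt_nondegenerate_holds C ιC hC c₀).1.mp fun x y => ?_, fun x hx => ?_⟩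
      · rw [← hc₀, ← hc₀]
        exact hφH.symm x y
      · rw [← hc₀]
        exact hφpos x hx
    /- «and since `(x, y)_c` is Hermitian for `B^opp`, we have `i(b) c = c i(b*)*` for all `b ∈ B`.» -/
    have hrel : ∀ b : B, i b * c₀ = c₀ * ιC (i (ι b)) := fun b => by
      refine index_injective hC fun x y => ?_
      have h := hφH.smul_left ((1 : C) ⊗ₜ[ℝ] op b) x y
      rw [sigma_tmul, hsm, hsm, unop_op, unop_op, one_mul, invol_map_one hιC, one_mul, hc₀, hc₀] at h
      unfold trForm at h ⊢
      rw [hιC.map_mul] at h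
      simpa only [mul_assoc] using h
    /- «Write `c = d d*` for some `d ∈ C^×`» (Lemma 2.8) -/
    obtain ⟨d, hd⟩ := exists_units_of_mem_posElts hC hposC hc₀pos
    /- «Then `Int(d)⁻¹ ∘ i` is a `*`-homomorphism.» -/
    let j : B →ₐ[ℝ] C :=
      { toFun := fun b => ((d⁻¹ : Cˣ) : C) * i b * (d : C)
        map_one' := by rw [map_one, mul_one, Units.inv_mul]
        map_mul' := fun x y => by
          rw [map_mul]
          simp only [mul_assoc, Units.mul_inv_cancel_left]
        map_zero' := by rw [map_zero, mul_zero, zero_mul]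
        map_add' := fun x y => by rw [map_add, mul_add, add_mul]
        commutes' := fun r => by
          rw [AlgHom.commutes, ← Algebra.commutes r ((d⁻¹ : Cˣ) : C), mul_assoc, Units.inv_mul, mul_one] }
    have hj : ∀ b : B, j b = ((d⁻¹ : Cˣ) : C) * i b * (d : C) := fun b => rfl
    refine ⟨d⁻¹, j, fun b => ?_, fun b => by rw [inv_inv, hj]⟩
    rw [hj, hj, hιC.map_mul, hιC.map_mul]
    have h := congrArg (fun t => ((d⁻¹ : Cˣ) : C) * t * ιC ((d⁻¹ : Cˣ) : C)) (hrel (ι b))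
    simp only [hι.apply_apply, hd, mul_assoc, invol_units_mul_inv hιC d, mul_one, Units.inv_mul_cancel_left] at h
    simpa only [mul_assoc] using h
  · /- §5 SECOND STATEMENT.  `i₂ = Int(u) ∘ i₁`; «Using `i₁` … we regard `C` as a … `C ⊗_ℝ B^opp`-module» -/
    obtain ⟨u, hu⟩ := hconj
    letI : Module Bᵐᵒᵖ C := Module.compHom C (RingHom.op i₁.toRingHom)
    have hsmulB : ∀ (b : Bᵐᵒᵖ) (x : C), b • x = x * i₁ (unop b) := fun b x => rfl
    haveI : IsScalarTower ℝ Bᵐᵒᵖ C :=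
      ⟨fun r b x => by rw [hsmulB, hsmulB, unop_smul, map_smul, mul_smul_comm]⟩
    haveI : SMulCommClass C Bᵐᵒᵖ C :=
      ⟨fun c b x => by rw [hsmulB, hsmulB, smul_eq_mul, smul_eq_mul, mul_assoc]⟩
    letI : Module (C ⊗[ℝ] Bᵐᵒᵖ) C := TensorProduct.Algebra.module
    have hsm : ∀ (c : C) (b : Bᵐᵒᵖ) (x : C), (c ⊗ₜ[ℝ] b) • x = c * (x * i₁ (unop b)) := fun c b x =>
      TensorProduct.Algebra.smul_def c b x
    haveI : IsScalarTower ℝ (C ⊗[ℝ] Bᵐᵒᵖ) C := tensor_isScalarTower i₁ hsm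
    haveI : Module.Finite (C ⊗[ℝ] Bᵐᵒᵖ) C := Module.Finite.of_restrictScalars_finite ℝ _ _
    /- `h = u* u` commutes with `i₁(B)`, because `i₁` and `i₂ = Int(u) ∘ i₁` are both `*`-homomorphisms -/
    have hcommh : ∀ b : B, ιC (u : C) * u * i₁ b = i₁ b * (ιC (u : C) * u) := fun b => by
      have e1 := h₂ (ι b)
      rw [hι.apply_apply, hu, hu, h₁ b, hιC.map_mul, hιC.map_mul, hιC.apply_apply] at e1
      have e2 := congrArg (fun t => ιC (u : C) * t * (u : C)) e1
      simpa only [mul_assoc, Units.inv_mul, mul_one, invol_units_mul_inv_cancel_left hιC] using e2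
    have hcommg : ∀ b : B, i₁ b * (((u⁻¹ : Cˣ) : C) * ιC ((u⁻¹ : Cˣ) : C)) =
        ((u⁻¹ : Cˣ) : C) * ιC ((u⁻¹ : Cˣ) : C) * i₁ b := fun b => by
      have e := congrArg (fun t => ((u⁻¹ : Cˣ) : C) * ιC ((u⁻¹ : Cˣ) : C) * t *
        (((u⁻¹ : Cˣ) : C) * ιC ((u⁻¹ : Cˣ) : C))) (hcommh b)
      simpa only [mul_assoc, invol_units_inv_mul_cancel_left hιC, invol_units_mul_inv hιC, Units.inv_mul_cancel_left,
        Units.mul_inv_cancel_left, mul_one] using e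
    /- the two positive definite Hermitian forms on the ONE module `(C, i₁)`: `Φ = tr(x y*) = (x, y)_1` and its transport
    `Φ' = tr(x u⁻¹ (y u⁻¹)*) = (x, y)_{u⁻¹ (u⁻¹)*}` along `x ↦ x u⁻¹ : (C, i₁) ≅ (C, i₂)` -/
    obtain ⟨Φ, hΦ⟩ := exists_bilinForm_trForm ιC (1 : C)
    obtain ⟨Φ', hΦ'⟩ := exists_bilinForm_trForm ιC (((u⁻¹ : Cˣ) : C) * ιC ((u⁻¹ : Cˣ) : C))
    have h1pos : (1 : C) ∈ posElts ιC := by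
      have h := mul_invol_mem_posElts hC hposC 1
      rwa [Units.val_one, invol_map_one hιC, mul_one] at h
    have hΦP := isPosDefHermitianForm_index hι hC i₁ h₁ hsm h1pos (fun b => by rw [mul_one, one_mul]) hΦ
    have hΦ'P := isPosDefHermitianForm_index hι hC i₁ h₁ hsm (mul_invol_mem_posElts hC hposC u⁻¹) hcommg hΦ'
    /- «therefore by Lemma 2.6 they are isomorphic as Hermitian modules» -/
    obtain ⟨S, hS⟩ := (Kottwitz1992_2_6_2_iso_iff_holds _ hA hposA C C Φ' Φ hΦ'P hΦP).mpr ⟨LinearEquiv.refl _ C⟩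
    obtain ⟨v, hSv, hvcomm⟩ := linearEquiv_structure i₁ hsm S
    /- «right multiplication by `c` preserves the form»: `v v* = u⁻¹ (u⁻¹)*` -/
    have hvg : (v : C) * ιC v = ((u⁻¹ : Cˣ) : C) * ιC ((u⁻¹ : Cˣ) : C) :=
      index_injective hC fun x y => by
        rw [← hΦ' x y, ← hS x y, hΦ, hSv x, hSv y, ← trForm_conj hιC (v : C) 1 x y, mul_one]
    /- `c = u v` -/
    refine ⟨u * v, ?_, fun b => ?_⟩
    · rw [Units.val_mul, hιC.map_mul]
      calc (u : C) * v * (ιC (v : C) * ιC (u : C)) = (u : C) * ((v : C) * ιC v) * ιC (u : C) := by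
            simp only [mul_assoc]
        _ = 1 := by rw [hvg, Units.mul_inv_cancel_left, invol_units_inv_mul hιC u]
    · rw [hu b, Units.val_mul, mul_inv_rev, Units.val_mul]
      -- `u i₁(b) u⁻¹ = u v i₁(b) v⁻¹ u⁻¹` since `v` commutes with `i₁(b)`
      have hv : i₁ b = (v : C) * i₁ b * ((v⁻¹ : Cˣ) : C) := by rw [← hvcomm b, Units.mul_inv_cancel_right]
      conv_lhs => rw [hv]
      simp only [mul_assoc]

end LemmaTwoTen

end Literature.NumberTheory.Kottwitz1992.Involutions

end
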